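import Literature.NumberTheory.ModularForms.HeckeOperatorsLevelOneEisensteinSigma
import Literature.NumberTheory.ModularForms.LevelOneHeckeRingLattice
import Literature.NumberTheory.EllipticCurves.EisensteinCongruence
import HarnessLib

/-!
# A cusp form congruent to `G_k` modulo the numerator of `B_k/2k` (Datskovsky–Guerzhoy, Thm. 1 and Cor. 1.1)

B. Datskovsky, P. Guerzhoy, *On Ramanujan congruences for modular forms of integral and half-integral weights*,
Proc. Amer. Math. Soc. **124** (1996) 2283–2291, §1 (open AMS text, p. 2284–2285), verbatim:

> "Let `G_k(z) = −B_k/2k + Σ_{n≥1} σ_{k−1}(n)qⁿ`, where `B_k` is the `k`th Bernoulli number, be the normalized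
> Eisenstein series of weight `k`, and let `N_k` denote the numerator of the reduced fraction `B_k/2k`. Then we have
> **Theorem 1.** For any even integer `k ≥ 12` there exists a nonzero cusp form `f` of weight `k` with rational Fourier
> coefficients such that `f ≡ G_k mod N_k`.
> *Proof.* Let `E_k = −(2k/B_k)G_k` be the Eisenstein series of weight `k`, normalized so that its constant term is
> equal to `1`. … Using `E₄` and `E₆` it is now easy to construct a form `h` of weight `k` with the constant term `1`
> and integral Fourier coefficients. Let `f = G_k + (B_k/2k)h`. Then `f` is a cusp form with rational Fourier
> coefficients; moreover, `f ≡ G_k mod N_k`. Since `N_k > 1` for `k ≥ 12` and the first Fourier coefficient of `G_k`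
> is `1`, `f ≠ 0`.
> **Corollary 1.1.** Suppose `dim S_k = 1`. Let `f_k` denote the unique cusp form of weight `k` normalized so that
> its first Fourier coefficient is `1`. Then `f_k ≡ G_k mod N_k`."

(DG's Definition, p. 2284: "We call two modular forms `f` and `g` on `SL(2, ℤ)` congruent modulo `I`, and write
`f ≡ g mod I`, if all Fourier coefficients of `f − g` are in `I·O_I`", `O_I = S_I⁻¹O_K`, `S_I = {a ∈ O_K : (a, I) = 1}`;
for `K = ℚ`, `I = (N)`: a rational number lies in `N·ℤ_{(N)}` iff it is `N·a/s` with `a ∈ ℤ` and `(s, N) = 1` —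
`RatCongr` below.)

Everything is PROVED, on Mathlib's `ModularForm 𝒮ℒ k` / `CuspForm 𝒮ℒ k`, following the printed proof: `G_k` is
the scalar multiple `(−B_k/2k)·E_k` of Mathlib's normalised Eisenstein series `ModularForm.E` (whose `q`-expansion
`1 − (2k/B_k)Σσ_{k−1}(n)qⁿ` is `EisensteinSeries.E_qExpansion_coeff`), the form `h` is the tree's
`exists_mem_levelOneIntegralForms_coeff_zero_eq_one` (a monomial `E₄ᵃE₆ᵇ ∈ M_k(ℤ)` with constant term `1`), and
`f = G_k + (B_k/2k)h`. We also record the INTEGRAL AVATAR `g = D_k·f = D_k G_k + s_k h ∈ S_k(ℤ)` (`B_k/2k = s_k/D_k`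
in lowest terms, `N_k = |s_k|`), which is what the sequel files use: `g` has integer coefficients
`g_n ≡ D_k σ_{k−1}(n) (mod N_k)` (`n ≥ 1`), `a₁(g) ≡ D_k` is a unit modulo `N_k`, and — because `G_k` is a Hecke
eigenform with `T(n)G_k = σ_{k−1}(n)G_k` (the tree's `heckeT_eisensteinE_eq_sigma_smul`) and `M_k(ℤ)` is
`T(n)`-stable — `T(n)g ≡ σ_{k−1}(n)·g (mod N_k·S_k(ℤ))`: `g` is a Hecke eigenvector modulo `N_k` with the Eisenstein
eigenvalues.

Remark on the printed "nonzero": `N_k > 1` fails for `k = 14` (`B₁₄/28 = 1/24`, and indeed `S₁₄ = 0`); we prove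
`f ≠ 0` under the hypothesis `N_k ≠ 1` (last conjunct of `exists_cuspForm_ratCongr_eisensteinG`), which is what the
printed argument uses; that `N_k ≠ 1` whenever `S_k ≠ 0` is not claimed here.

## Contents (definitions with bodies + theorems; no named fact)

* §1 `bernoulliRatio k = B_k/2k`, `eisensteinNumerator k = N_k`, `eisensteinDenominator k = D_k` (lowest terms),
  `bernoulli_ne_zero_of_even` (from the tree's von Staudt–Clausen valuation at `ℓ = 2`), coprimality.
* §2 `levelOneEisensteinG hk = G_k`, ★`qExpansion_coeff_levelOneEisensteinG` (`−B_k/2k`, `σ_{k−1}(n)`),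
  ★`heckeT_levelOneEisensteinG` (`T(n)G_k = σ_{k−1}(n)G_k`).
* §3 `RatCongr N x y` (DG's `x ≡ y mod N·ℤ_{(N)}` for rationals) and its API.
* §4 ★**`exists_integral_cuspForm_congr_eisensteinG`** (the integral avatar `g ∈ S_k(ℤ)`, `g_n ≡ D_kσ_{k−1}(n)`,
  `a₁(g) ≡ D_k (mod N_k)`, `T(n)g − σ_{k−1}(n)g ∈ N_k·S_k(ℤ)`), ★**`exists_cuspForm_ratCongr_eisensteinG`** (DG
  Theorem 1 as printed: rational coefficients, `f ≡ G_k mod N_k`, and `f ≠ 0` when `N_k ≠ 1`).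
* §5 ★**`IsNormalizedCuspEigenform.congr_eisensteinG_of_finrank_eq_one`** (DG Corollary 1.1: `dim S_k = 1 ⟹
  a_n(f_k) ≡ σ_{k−1}(n) (mod N_k)` for the normalized cusp form, all `n ≥ 1`).

## References

* [DatskovskyGuerzhoy1996] B. Datskovsky, P. Guerzhoy, Proc. AMS 124 (1996) 2283–2291, §1: Definition, Theorem 1,
  Corollary 1.1 (p. 2284–2285).
* [Serre1973] J.-P. Serre, *A Course in Arithmetic*, GTM 7, Ch. VII §4.1 (34) (`E_k`), §5.5 (`T(n)G_k = σ_{2k−1}(n)G_k`),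
  §5.6.2 (`M_k(ℤ)`).
-/

noncomputable section

open scoped MatrixGroups ModularForm
open UpperHalfPlane hiding I
open ArithmeticFunction (sigma sigma_one sigma_apply)

namespace Literature.NumberTheory.ModularForms

/-! ## §1 The numbers `B_k/2k = s_k/D_k`, `N_k = |s_k|` -/

section Numbers

/-- **`B_k/2k`**, the negative of the constant term of `G_k`. [cite: DatskovskyGuerzhoy1996, §1 (definition of `G_k`)] -/
def bernoulliRatio (k : ℕ) : ℚ := bernoulli k / (2 * k)

/-- Unfolding lemma. [cite: DatskovskyGuerzhoy1996, §1] -/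
theorem bernoulliRatio_def (k : ℕ) : bernoulliRatio k = bernoulli k / (2 * k) := rfl

/-- **`N_k`**: "the numerator of the reduced fraction `B_k/2k`" (taken positive).
[cite: DatskovskyGuerzhoy1996, §1 (definition of `N_k`)] -/
def eisensteinNumerator (k : ℕ) : ℕ := (bernoulliRatio k).num.natAbs

/-- **`D_k`**: the denominator of the reduced fraction `B_k/2k`. [cite: DatskovskyGuerzhoy1996, §1] -/
def eisensteinDenominator (k : ℕ) : ℕ := (bernoulliRatio k).den

/-- Unfolding lemma. [cite: DatskovskyGuerzhoy1996, §1] -/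
theorem eisensteinNumerator_def (k : ℕ) : eisensteinNumerator k = (bernoulliRatio k).num.natAbs := rfl

/-- Unfolding lemma. [cite: DatskovskyGuerzhoy1996, §1] -/
theorem eisensteinDenominator_def (k : ℕ) : eisensteinDenominator k = (bernoulliRatio k).den := rfl

/-- `D_k > 0`. [cite: DatskovskyGuerzhoy1996, §1 (definition of `N_k`, "the reduced fraction `B_k/2k`")] -/
theorem eisensteinDenominator_pos (k : ℕ) : 0 < eisensteinDenominator k := Rat.den_pos _

/-- `(N_k, D_k) = 1` (lowest terms). [cite: DatskovskyGuerzhoy1996, §1 (definition of `N_k`, "the reduced fraction `B_k/2k`")] -/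
theorem eisensteinNumerator_coprime_eisensteinDenominator (k : ℕ) :
    (eisensteinNumerator k).Coprime (eisensteinDenominator k) :=
  (bernoulliRatio k).reduced

/-- `|s_k| = N_k` as integers (`s_k` the signed numerator). [cite: DatskovskyGuerzhoy1996, §1 (definition of `N_k`)] -/
theorem natCast_eisensteinNumerator (k : ℕ) :
    ((eisensteinNumerator k : ℕ) : ℤ) = |(bernoulliRatio k).num| :=
  Int.natCast_natAbs _

/-- `s_k ∣ m ↔ N_k ∣ m`. [cite: DatskovskyGuerzhoy1996, §1 (definition of `N_k`)] -/
theorem eisensteinNumerator_dvd_iff (k : ℕ) (m : ℤ) :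
    ((eisensteinNumerator k : ℕ) : ℤ) ∣ m ↔ (bernoulliRatio k).num ∣ m := by
  rw [eisensteinNumerator, Int.natAbs_dvd]

/-- `B_k/2k · D_k = s_k`. [cite: DatskovskyGuerzhoy1996, §1 (definition of `N_k`, "the reduced fraction `B_k/2k`")] -/
theorem bernoulliRatio_mul_eisensteinDenominator (k : ℕ) :
    bernoulliRatio k * eisensteinDenominator k = (bernoulliRatio k).num :=
  Rat.mul_den_eq_num _

/-- **`B_k ≠ 0` for even `k ≠ 0`** (von Staudt–Clausen: `v₂(B_k) = −1`). [cite: Serre1973, Ch. VII §4.1 (the values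
of `ζ(2k)`)] -/
theorem bernoulli_ne_zero_of_even {k : ℕ} (hk2 : Even k) (hk0 : k ≠ 0) : bernoulli k ≠ 0 := by
  intro h
  have hv := Literature.NumberTheory.EllipticCurves.ModularForms.DeligneSerre1974.padicValuation_bernoulli_eq
    (ℓ := 2) hk2 hk0 (by norm_num)
  rw [h, map_zero] at hv
  exact WithZero.zero_ne_coe hv

/-- `B_k/2k ≠ 0` for even `k ≠ 0`. [cite: Serre1973, Ch. VII §4.1 (values of `ζ(2k)`, `B_{2k} ≠ 0`)] -/
theorem bernoulliRatio_ne_zero {k : ℕ} (hk2 : Even k) (hk0 : k ≠ 0) : bernoulliRatio k ≠ 0 := by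
  rw [bernoulliRatio]
  exact div_ne_zero (bernoulli_ne_zero_of_even hk2 hk0) (by positivity)

/-- `N_k ≠ 0` for even `k ≠ 0`. [cite: Serre1973, Ch. VII §4.1 (`B_{2k} ≠ 0`)] [cite: DatskovskyGuerzhoy1996, §1] -/
theorem eisensteinNumerator_ne_zero {k : ℕ} (hk2 : Even k) (hk0 : k ≠ 0) : eisensteinNumerator k ≠ 0 := by
  rw [eisensteinNumerator, ne_eq, Int.natAbs_eq_zero, Rat.num_eq_zero]
  exact bernoulliRatio_ne_zero hk2 hk0

/-- `B_k/2k = s_k / D_k` in `ℂ`. [cite: DatskovskyGuerzhoy1996, §1 ("the reduced fraction `B_k/2k`")] -/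
theorem bernoulliRatio_eq_num_div_den (k : ℕ) :
    ((bernoulliRatio k : ℚ) : ℂ) = ((bernoulliRatio k).num : ℂ) / (eisensteinDenominator k : ℂ) := by
  rw [eisensteinDenominator, ← Rat.cast_intCast (α := ℂ), ← Rat.cast_natCast (α := ℂ), ← Rat.cast_div,
    Rat.num_div_den]

end Numbers

/-! ## §2 The Eisenstein series `G_k = −B_k/2k + Σ σ_{k−1}(n) qⁿ` -/

section EisensteinG

/-- **`G_k = −B_k/2k + Σ_{n≥1} σ_{k−1}(n)qⁿ`**, the Eisenstein series of even weight `k ≥ 4` on `SL₂(ℤ)` in the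
normalisation of Datskovsky–Guerzhoy (`= (−B_k/2k)·E_k` with `E_k` Mathlib's `ModularForm.E`, constant term `1`).
[cite: DatskovskyGuerzhoy1996, §1 (definition of `G_k`, "`E_k = −(2k/B_k)G_k`")] [cite: Serre1973, Ch. VII §4.1 (34)] -/
def levelOneEisensteinG {k : ℕ} (hk : 3 ≤ k) : ModularForm 𝒮ℒ k :=
  ((-bernoulliRatio k : ℚ) : ℂ) • ModularForm.E hk

/-- Unfolding lemma: `G_k = (−B_k/2k) • E_k`. [cite: DatskovskyGuerzhoy1996, §1] -/
theorem levelOneEisensteinG_def {k : ℕ} (hk : 3 ≤ k) :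
    levelOneEisensteinG hk = ((-bernoulliRatio k : ℚ) : ℂ) • ModularForm.E hk := rfl

/-- ★ **The `q`-expansion of `G_k`**: constant term `−B_k/2k`, and `σ_{k−1}(n)` for `n ≥ 1`.
[cite: DatskovskyGuerzhoy1996, §1 ("`G_k(z) = −B_k/2k + Σ σ_{k−1}(n)qⁿ`")] [cite: Serre1973, Ch. VII §4.1 (34)] -/
theorem qExpansion_coeff_levelOneEisensteinG {k : ℕ} (hk : 3 ≤ k) (hk2 : Even k) (m : ℕ) :
    (qExpansion 1 (levelOneEisensteinG hk)).coeff m =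
      if m = 0 then ((-bernoulliRatio k : ℚ) : ℂ) else (sigma (k - 1) m : ℂ) := by
  rw [levelOneEisensteinG_def, ModularForm.IsGLPos.coe_smul,
    ModularForm.qExpansion_smul one_pos one_mem_strictPeriods_SL, map_smul, smul_eq_mul,
    EisensteinSeries.E_qExpansion_coeff hk hk2 m]
  split_ifs with hm
  · rw [mul_one]
  · have hB : ((bernoulli k : ℚ) : ℂ) ≠ 0 := by
      exact_mod_cast bernoulli_ne_zero_of_even hk2 (by omega)
    have hk0 : ((k : ℕ) : ℂ) ≠ 0 := by exact_mod_cast (show k ≠ 0 by omega)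
    rw [bernoulliRatio, Rat.cast_neg, Rat.cast_div, Rat.cast_mul, Rat.cast_natCast, Rat.cast_ofNat]
    field_simp

/-- `a₀(G_k) = −B_k/2k`. [cite: DatskovskyGuerzhoy1996, §1] -/
theorem qExpansion_coeff_levelOneEisensteinG_zero {k : ℕ} (hk : 3 ≤ k) (hk2 : Even k) :
    (qExpansion 1 (levelOneEisensteinG hk)).coeff 0 = ((-bernoulliRatio k : ℚ) : ℂ) := by
  rw [qExpansion_coeff_levelOneEisensteinG hk hk2, if_pos rfl]

/-- `a_n(G_k) = σ_{k−1}(n)` for `n ≥ 1`. [cite: DatskovskyGuerzhoy1996, §1] -/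
theorem qExpansion_coeff_levelOneEisensteinG_of_pos {k : ℕ} (hk : 3 ≤ k) (hk2 : Even k) {n : ℕ} (hn : 0 < n) :
    (qExpansion 1 (levelOneEisensteinG hk)).coeff n = (sigma (k - 1) n : ℂ) := by
  rw [qExpansion_coeff_levelOneEisensteinG hk hk2, if_neg hn.ne']

/-- `a₁(G_k) = 1` ("the first Fourier coefficient of `G_k` is `1`"). [cite: DatskovskyGuerzhoy1996, §1 (proof of Thm. 1)] -/
theorem qExpansion_coeff_levelOneEisensteinG_one {k : ℕ} (hk : 3 ≤ k) (hk2 : Even k) :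
    (qExpansion 1 (levelOneEisensteinG hk)).coeff 1 = 1 := by
  rw [qExpansion_coeff_levelOneEisensteinG_of_pos hk hk2 one_pos, sigma_one, Nat.cast_one]

/-- ★ **`T(n) G_k = σ_{k−1}(n) G_k`** for every `n ≥ 1`: `G_k` is a simultaneous Hecke eigenform with the
Eisenstein eigenvalues. [cite: Serre1973, Ch. VII §5.5 a) ("the eigenvalues of `T(n)` are `σ_{2k−1}(n)`")]
[cite: DatskovskyGuerzhoy1996, §1 (proof of Lemma 2.1: "`T_n` … `σ_{k−1}(n) … G_k`")] -/
theorem heckeT_levelOneEisensteinG {k : ℕ} (hk : 3 ≤ k) (hk2 : Even k) {n : ℕ} (hn : 0 < n) :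
    heckeT hn (levelOneEisensteinG hk) = (sigma (k - 1) n : ℂ) • levelOneEisensteinG hk := by
  rw [levelOneEisensteinG_def, heckeT_smul, heckeT_eisensteinE_eq_sigma_smul hk hk2 hn, smul_comm]

end EisensteinG

/-! ## §3 Congruences of rational numbers modulo `N·ℤ_{(N)}` (DG's Definition for `K = ℚ`) -/

section RatCongr

/-- **`x ≡ y mod N`** for rational `x, y` in the sense of Datskovsky–Guerzhoy: `x − y ∈ N·ℤ_{(N)}`, i.e.
`x − y = N·a/s` with `a ∈ ℤ` and `(s, N) = 1` ("all Fourier coefficients of `f − g` are in `I·O_I`", `O_I = S_I⁻¹O_K`,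
here `K = ℚ`, `I = (N)`). [cite: DatskovskyGuerzhoy1996, §1 Definition] -/
def RatCongr (N : ℕ) (x y : ℚ) : Prop :=
  ∃ s : ℕ, s.Coprime N ∧ ∃ a : ℤ, (x - y) * s = N * a

/-- Unfolding lemma. [cite: DatskovskyGuerzhoy1996, §1 Definition] -/
theorem ratCongr_iff (N : ℕ) (x y : ℚ) : RatCongr N x y ↔ ∃ s : ℕ, s.Coprime N ∧ ∃ a : ℤ, (x - y) * s = N * a :=
  Iff.rfl

/-- Reflexivity of DG's congruence. [cite: DatskovskyGuerzhoy1996, §1 Definition] -/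
theorem RatCongr.refl (N : ℕ) (x : ℚ) : RatCongr N x x :=
  ⟨1, Nat.coprime_one_left N, 0, by simp⟩

/-- For integers, `x ≡ y mod N` in DG's sense iff `N ∣ x − y` in `ℤ` (`ℤ ∩ N·ℤ_{(N)} = Nℤ`).
[cite: DatskovskyGuerzhoy1996, §1 Definition] -/
theorem ratCongr_intCast_iff {N : ℕ} {x y : ℤ} : RatCongr N (x : ℚ) (y : ℚ) ↔ (N : ℤ) ∣ x - y := by
  constructor
  · rintro ⟨s, hs, a, ha⟩
    have h : (x - y) * (s : ℤ) = N * a := by exact_mod_cast ha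
    have hdvd : (N : ℤ) ∣ (x - y) * s := ⟨a, h⟩
    exact Int.dvd_of_dvd_mul_left_of_gcd_one hdvd (by
      rw [Int.gcd_comm, Int.gcd_natCast_natCast]
      exact hs)
  · rintro ⟨a, ha⟩
    exact ⟨1, Nat.coprime_one_left N, a, by push_cast; rw [mul_one, ← Int.cast_sub, ha]; push_cast; ring⟩

/-- Division by an integer prime to `N` preserves congruences: `N ∣ x − y` in `ℤ` and `(D, N) = 1` give
`x/D ≡ y/D mod N` (the point of DG's localisation `O_I = S_I⁻¹O_K`). [cite: DatskovskyGuerzhoy1996, §1 Definition] -/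
theorem ratCongr_div_of_dvd_sub {N D : ℕ} (hD : D.Coprime N) {x y : ℤ} (h : (N : ℤ) ∣ x - y) :
    RatCongr N ((x : ℚ) / D) ((y : ℚ) / D) := by
  rcases Nat.eq_zero_or_pos D with rfl | hDpos
  · simp only [Nat.cast_zero, div_zero]
    exact RatCongr.refl N 0
  · obtain ⟨a, ha⟩ := h
    refine ⟨D, hD, a, ?_⟩
    have hD0 : (D : ℚ) ≠ 0 := by exact_mod_cast hDpos.ne'
    rw [← sub_div, div_mul_cancel₀ _ hD0, ← Int.cast_sub, ha]
    push_cast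
    ring

end RatCongr

/-! ## §4 Theorem 1: a cusp form congruent to `G_k` modulo `N_k` -/

section TheoremOne

variable {k : ℕ}

/-- The `n`-th coefficient of a scalar combination `a • F + b • H` of level-one forms. [folklore] -/
private theorem coeff_smul_add_smul (a b : ℂ) (F H : ModularForm 𝒮ℒ k) (n : ℕ) :
    (qExpansion 1 ⇑((a • F + b • H : ModularForm 𝒮ℒ k))).coeff n =
      a * (qExpansion 1 ⇑F).coeff n + b * (qExpansion 1 ⇑H).coeff n := by
  rw [ModularForm.coe_add, ModularForm.qExpansion_add one_pos one_mem_strictPeriods_SL, map_add,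
    ModularForm.IsGLPos.coe_smul, ModularForm.qExpansion_smul one_pos one_mem_strictPeriods_SL,
    ModularForm.IsGLPos.coe_smul, ModularForm.qExpansion_smul one_pos one_mem_strictPeriods_SL, map_smul, map_smul,
    smul_eq_mul, smul_eq_mul]

/-- The `n`-th coefficient of `T(m)f − c • f` for a cusp form `f`. [folklore] -/
private theorem coeff_heckeTCusp_sub_smul {n : ℕ} (hn : 0 < n) (c : ℂ) (f : CuspForm 𝒮ℒ k) (m : ℕ) :
    (qExpansion 1 ⇑(heckeTCusp hn f - c • f)).coeff m =
      (qExpansion 1 ⇑(heckeTCusp hn f)).coeff m - c * (qExpansion 1 ⇑f).coeff m := by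
  rw [CuspForm.coe_sub, ModularForm.qExpansion_sub one_pos one_mem_strictPeriods_SL, map_sub,
    CuspForm.IsGLPos.coe_smul, ModularForm.qExpansion_smul one_pos one_mem_strictPeriods_SL, map_smul, smul_eq_mul]

/-- ★ **The integral avatar of DG's Theorem 1.** For even `k ≥ 4` write `B_k/2k = s_k/D_k` in lowest terms
(`N_k = |s_k|`). There is a cusp form `g ∈ S_k(ℤ)` (namely `g = D_k G_k + s_k h = D_k·f` with DG's `h` and `f`) such
that, for every `n ≥ 1`: its `n`-th coefficient is an integer `≡ D_k σ_{k−1}(n) (mod N_k)` (so `a₁(g) ≡ D_k`, a unit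
modulo `N_k`), and `T(n)g − σ_{k−1}(n)·g ∈ N_k · S_k(ℤ)` — `g` is a Hecke eigenvector modulo `N_k` with the Eisenstein
eigenvalues `σ_{k−1}(n)`. [cite: DatskovskyGuerzhoy1996, Thm. 1 (proof: "`f = G_k + (B_k/2k)h` … `f ≡ G_k mod N_k`")]
[cite: Serre1973, Ch. VII §5.5 a), §5.6.2 (`M_k(ℤ)` is `T(n)`-stable)] -/
theorem exists_integral_cuspForm_congr_eisensteinG (hk : 3 ≤ k) (hk2 : Even k) :
    ∃ g : CuspForm 𝒮ℒ k, g ∈ levelOneIntegralCuspForms k ∧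
      (∀ n, 0 < n → ∃ m : ℤ, (m : ℂ) = (qExpansion 1 ⇑g).coeff n ∧
        ((eisensteinNumerator k : ℕ) : ℤ) ∣ m - eisensteinDenominator k * sigma (k - 1) n) ∧
      ∀ (n : ℕ) (hn : 0 < n), ∃ r : CuspForm 𝒮ℒ k, r ∈ levelOneIntegralCuspForms k ∧
        heckeTCusp hn g - (sigma (k - 1) n : ℂ) • g = ((eisensteinNumerator k : ℕ) : ℂ) • r := by
  -- DG's `h`: an integral form of weight `k` with constant term `1`.
  obtain ⟨h, hh, hh0⟩ := exists_mem_levelOneIntegralForms_coeff_zero_eq_one k hk2 (by omega)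
  set s : ℤ := (bernoulliRatio k).num with hs
  set D : ℕ := eisensteinDenominator k with hD
  -- `g = D_k G_k + s_k h`, an integral modular form with vanishing constant term.
  set G : ModularForm 𝒮ℒ k := (D : ℂ) • levelOneEisensteinG hk + (s : ℂ) • h with hG
  have hGcoeff : ∀ n, (qExpansion 1 G).coeff n =
      (D : ℂ) * (qExpansion 1 (levelOneEisensteinG hk)).coeff n + (s : ℂ) * (qExpansion 1 h).coeff n := fun n =>
    coeff_smul_add_smul _ _ _ _ n
  have hG0 : (qExpansion 1 G).coeff 0 = 0 := by
    rw [hGcoeff, qExpansion_coeff_levelOneEisensteinG_zero hk hk2, hh0, mul_one, Rat.cast_neg,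
      bernoulliRatio_eq_num_div_den, ← hD, ← hs, mul_neg,
      mul_div_cancel₀ _ (by exact_mod_cast (eisensteinDenominator_pos k).ne' : (D : ℂ) ≠ 0), neg_add_cancel]
  obtain ⟨hc, hhc⟩ : ∃ hc : ℕ → ℤ, ∀ n, ((hc n : ℤ) : ℂ) = (qExpansion 1 h).coeff n :=
    ⟨fun n => (mem_levelOneIntegralForms.mp hh n).choose, fun n => (mem_levelOneIntegralForms.mp hh n).choose_spec⟩
  have hGint : ∀ n, 0 < n → (((D : ℤ) * sigma (k - 1) n + s * hc n : ℤ) : ℂ) = (qExpansion 1 G).coeff n := by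
    intro n hn
    rw [hGcoeff, qExpansion_coeff_levelOneEisensteinG_of_pos hk hk2 hn, ← hhc n]
    push_cast
    ring
  have hGmem : G ∈ levelOneIntegralForms k := by
    rw [mem_levelOneIntegralForms]
    intro n
    rcases Nat.eq_zero_or_pos n with rfl | hn
    · exact ⟨0, by rw [hG0, Int.cast_zero]⟩
    · exact ⟨_, hGint n hn⟩
  set g : CuspForm 𝒮ℒ k := ModularForm.toCuspForm G hG0 with hg
  have hgG : CuspForm.toModularFormₗ g = G := DFunLike.ext _ _ fun _ => rfl
  have hgq : qExpansion 1 ⇑g = qExpansion 1 ⇑G := rfl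
  have hgmem : g ∈ levelOneIntegralCuspForms k := by
    rw [mem_levelOneIntegralCuspForms_iff, hgG]
    exact hGmem
  refine ⟨g, hgmem, fun n hn => ⟨_, by rw [hgq]; exact hGint n hn, ?_⟩, fun n hn => ?_⟩
  · -- `g_n − D_k σ_{k−1}(n) = s_k h_n`, a multiple of `N_k = |s_k|`.
    rw [eisensteinNumerator_dvd_iff, ← hs]
    exact ⟨hc n, by ring⟩
  · -- `T(n)g − σ_{k−1}(n)g = s_k (T(n)h − σ_{k−1}(n)h)`, and `T(n)h − σ_{k−1}(n)h ∈ S_k(ℤ)`.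
    have hk1 : (1 : ℤ) ≤ k := by omega
    set R : ModularForm 𝒮ℒ k := heckeT hn h - (sigma (k - 1) n : ℂ) • h with hR
    have hRcoeff : ∀ m, (qExpansion 1 R).coeff m =
        (qExpansion 1 (heckeT hn h)).coeff m - (sigma (k - 1) n : ℂ) * (qExpansion 1 h).coeff m := by
      intro m
      rw [hR, ModularForm.coe_sub, ModularForm.qExpansion_sub one_pos one_mem_strictPeriods_SL, map_sub,
        ModularForm.IsGLPos.coe_smul, ModularForm.qExpansion_smul one_pos one_mem_strictPeriods_SL, map_smul,
        smul_eq_mul]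
    have hsum : ∑ ad ∈ n.divisorsAntidiagonal, ((ad.1 : ℕ) : ℂ) ^ ((k : ℤ) - 1) = (sigma (k - 1) n : ℂ) := by
      have h := Nat.sum_divisorsAntidiagonal (n := n) (f := fun a _ => ((a : ℕ) : ℂ) ^ ((k : ℤ) - 1))
      try dsimp only at h
      rw [h, sigma_apply, Nat.cast_sum]
      refine Finset.sum_congr rfl fun d _ => ?_
      rw [show ((k : ℤ) - 1) = ((k - 1 : ℕ) : ℤ) by omega, zpow_natCast, Nat.cast_pow]
    have hR0 : (qExpansion 1 R).coeff 0 = 0 := by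
      rw [hRcoeff, qExpansion_coeff_heckeT_zero, hh0, mul_one, mul_one, hsum, sub_self]
    have hRmem : R ∈ levelOneIntegralForms k :=
      sub_mem (heckeT_mem_levelOneIntegralForms hk1 hn hh) (by
        rw [show (sigma (k - 1) n : ℂ) • h = ((sigma (k - 1) n : ℕ) : ℤ) • h by
          rw [← Int.cast_smul_eq_zsmul ℂ, Int.cast_natCast]]
        exact Submodule.smul_mem _ _ hh)
    -- the sign of `s_k`: `s_k = ε N_k` with `ε = ±1`; put `r = ε (T(n)h − σ h)`.
    set ε : ℤ := Int.sign s with hε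
    have hsε : (s : ℂ) = (ε : ℂ) * ((eisensteinNumerator k : ℕ) : ℂ) := by
      have : s = ε * ((eisensteinNumerator k : ℕ) : ℤ) := by
        rw [natCast_eisensteinNumerator, ← hs, hε, Int.sign_mul_abs]
      exact_mod_cast this
    refine ⟨ModularForm.toCuspForm ((ε : ℂ) • R) (by
        rw [ModularForm.IsGLPos.coe_smul, ModularForm.qExpansion_smul one_pos one_mem_strictPeriods_SL, map_smul,
          hR0, smul_zero]), ?_, ?_⟩
    · rw [mem_levelOneIntegralCuspForms_iff]
      rw [show CuspForm.toModularFormₗ (ModularForm.toCuspForm ((ε : ℂ) • R) _) = (ε : ℂ) • R from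
        DFunLike.ext _ _ fun _ => rfl, Int.cast_smul_eq_zsmul]
      exact Submodule.smul_mem _ _ hRmem
    · -- compare underlying modular forms
      apply CuspForm.toModularFormₗ_injective
      rw [map_sub, map_smul, map_smul, toModularFormₗ_heckeTCusp, hgG,
        show CuspForm.toModularFormₗ (ModularForm.toCuspForm ((ε : ℂ) • R) _) = (ε : ℂ) • R from
          DFunLike.ext _ _ fun _ => rfl, hG, heckeT_add, heckeT_smul, heckeT_smul,
        heckeT_levelOneEisensteinG hk hk2 hn, hR, hsε]
      module

/-- ★ **Datskovsky–Guerzhoy, Theorem 1 (as printed).** For every even `k ≥ 4` there is a cusp form `f` of weight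
`k` on `SL₂(ℤ)` with rational Fourier coefficients such that `f ≡ G_k mod N_k` in DG's sense (every coefficient of
`f − G_k` lies in `N_k·ℤ_{(N_k)}`), namely `f = G_k + (B_k/2k)h`; and `f ≠ 0` as soon as `N_k ≠ 1` (printed:
"Since `N_k > 1` for `k ≥ 12` and the first Fourier coefficient of `G_k` is `1`, `f ≠ 0`").
[cite: DatskovskyGuerzhoy1996, Thm. 1] -/
theorem exists_cuspForm_ratCongr_eisensteinG (hk : 3 ≤ k) (hk2 : Even k) :
    ∃ f : CuspForm 𝒮ℒ k, ∃ c : ℕ → ℚ, (∀ n, ((c n : ℚ) : ℂ) = (qExpansion 1 ⇑f).coeff n) ∧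
      RatCongr (eisensteinNumerator k) (c 0) (-bernoulliRatio k) ∧
      (∀ n, 0 < n → RatCongr (eisensteinNumerator k) (c n) (sigma (k - 1) n)) ∧
      (eisensteinNumerator k ≠ 1 → f ≠ 0) := by
  obtain ⟨g, hgmem, hgcoeff, -⟩ := exists_integral_cuspForm_congr_eisensteinG hk hk2
  set D : ℕ := eisensteinDenominator k with hD
  have hD0 : (D : ℂ) ≠ 0 := by exact_mod_cast (eisensteinDenominator_pos k).ne'
  have hD0' : (D : ℚ) ≠ 0 := by exact_mod_cast (eisensteinDenominator_pos k).ne'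
  -- integer coefficients of `g`
  obtain ⟨gc, hgc⟩ : ∃ gc : ℕ → ℤ, ∀ n, ((gc n : ℤ) : ℂ) = (qExpansion 1 ⇑g).coeff n :=
    ⟨fun n => (mem_levelOneIntegralCuspForms.mp hgmem n).choose,
      fun n => (mem_levelOneIntegralCuspForms.mp hgmem n).choose_spec⟩
  -- `f = g / D_k`, coefficients `c n = gc n / D_k`
  refine ⟨((D : ℂ)⁻¹) • g, fun n => (gc n : ℚ) / D, fun n => ?_, ?_, fun n hn => ?_, fun hN => ?_⟩
  · show (((gc n : ℚ) / D : ℚ) : ℂ) = _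
    rw [CuspForm.IsGLPos.coe_smul, ModularForm.qExpansion_smul one_pos one_mem_strictPeriods_SL, map_smul,
      smul_eq_mul, ← hgc n]
    push_cast
    rw [div_eq_inv_mul]
  · -- constant term: `c 0 = 0` and `0 − (−B_k/2k) = s_k/D_k ∈ N_k ℤ_{(N_k)}`
    have hg0 : gc 0 = 0 := by
      have := hgc 0
      rw [CuspFormClass.qExpansion_coeff_zero g one_pos one_mem_strictPeriods_SL] at this
      exact_mod_cast this
    show RatCongr (eisensteinNumerator k) ((gc 0 : ℚ) / D) (-bernoulliRatio k)
    rw [hg0, Int.cast_zero, zero_div]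
    refine ⟨D, (eisensteinNumerator_coprime_eisensteinDenominator k).symm, (bernoulliRatio k).num.sign, ?_⟩
    rw [zero_sub, neg_neg, hD, eisensteinDenominator, Rat.mul_den_eq_num]
    have hZ : ((eisensteinNumerator k : ℕ) : ℤ) * (bernoulliRatio k).num.sign = (bernoulliRatio k).num := by
      rw [eisensteinNumerator, mul_comm, Int.sign_mul_natAbs]
    conv_lhs => rw [← hZ]
    push_cast
    ring
  · -- `c n − σ_{k−1}(n) = (gc n − D σ)/D`, and `N_k ∣ gc n − D σ`
    show RatCongr (eisensteinNumerator k) ((gc n : ℚ) / D) _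
    obtain ⟨m, hm, hdvd⟩ := hgcoeff n hn
    have hmn : m = gc n := by
      have := hm.trans (hgc n).symm
      exact_mod_cast this
    subst hmn
    have h := ratCongr_div_of_dvd_sub (eisensteinNumerator_coprime_eisensteinDenominator k).symm hdvd
    rw [← hD] at h
    have hσ : (((eisensteinDenominator k : ℤ) * (sigma (k - 1) n : ℕ) : ℤ) : ℚ) / D = sigma (k - 1) n := by
      rw [hD]
      push_cast
      rw [mul_div_cancel_left₀ _ hD0']
    rwa [hσ] at h
  · -- `f ≠ 0`: `a₁(g) ≡ D_k (mod N_k)` with `(D_k, N_k) = 1` and `N_k ≠ 1` forces `a₁(g) ≠ 0`.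
    intro hf
    have hg0 : g = 0 := by
      have := congrArg (fun F : CuspForm 𝒮ℒ k => (D : ℂ) • F) hf
      simpa only [smul_smul, mul_inv_cancel₀ hD0, one_smul, smul_zero] using this
    obtain ⟨m, hm, hdvd⟩ := hgcoeff 1 one_pos
    rw [hg0, CuspForm.coe_zero, qExpansion_zero, map_zero] at hm
    have hm0 : m = 0 := by exact_mod_cast hm
    rw [hm0, sigma_one, Nat.cast_one, mul_one, zero_sub, dvd_neg] at hdvd
    have h1 : (eisensteinNumerator k : ℕ) ∣ eisensteinDenominator k := by exact_mod_cast hdvd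
    exact hN (Nat.Coprime.eq_one_of_dvd (eisensteinNumerator_coprime_eisensteinDenominator k) h1)

end TheoremOne

/-! ## §5 Corollary 1.1: `dim S_k = 1` -/

section CorollaryOneOne

variable {k : ℕ}

/-- In an integral cusp form space of dimension one, a normalized eigenform is `a₁(g)⁻¹ g` for any integral `g`
with `a₁(g) ≠ 0`; we only need: every cusp form is a multiple of the normalized one. [folklore] -/
private theorem eq_coeff_one_smul_of_finrank_eq_one (hd : Module.finrank ℂ (CuspForm 𝒮ℒ (k : ℤ)) = 1)
    {f : CuspForm 𝒮ℒ k} (hf : IsNormalizedCuspEigenform f) (g : CuspForm 𝒮ℒ k) :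
    g = (qExpansion 1 ⇑g).coeff 1 • f := by
  haveI : FiniteDimensional ℂ (CuspForm 𝒮ℒ (k : ℤ)) := Module.finite_of_finrank_eq_succ hd
  obtain ⟨c, hc⟩ := (finrank_eq_one_iff_of_nonzero' f hf.ne_zero).mp hd g
  rw [← hc, CuspForm.IsGLPos.coe_smul, ModularForm.qExpansion_smul one_pos one_mem_strictPeriods_SL, map_smul,
    smul_eq_mul, hf.2, mul_one]

/-- ★ **Datskovsky–Guerzhoy, Corollary 1.1.** Suppose `dim S_k = 1` and let `f_k` be the cusp form of weight `k`
normalized by `a₁(f_k) = 1` (the normalized eigenform). Then `f_k ≡ G_k mod N_k`: every coefficient `a_n(f_k)`,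
`n ≥ 1`, is an integer congruent to `σ_{k−1}(n)` modulo `N_k` (printed proof: "By Theorem 1 `G_k` is congruent to
some multiple of `f_k` modulo `N_k`. Since the first Fourier coefficients of `G_k` and `f_k` are both `1`,
`G_k ≡ f_k mod N_k`"). For `k = 12` this is Ramanujan's `τ(n) ≡ σ₁₁(n) (mod 691)`; for `k = 16, 18, 20, 22, 26`
these are Manin's congruences. [cite: DatskovskyGuerzhoy1996, Cor. 1.1] -/
theorem IsNormalizedCuspEigenform.congr_eisensteinG_of_finrank_eq_one (hk : 3 ≤ k) (hk2 : Even k)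
    (hd : Module.finrank ℂ (CuspForm 𝒮ℒ (k : ℤ)) = 1) {f : CuspForm 𝒮ℒ k} (hf : IsNormalizedCuspEigenform f)
    {n : ℕ} (hn : 0 < n) :
    ∃ a : ℤ, (a : ℂ) = (qExpansion 1 ⇑f).coeff n ∧ ((eisensteinNumerator k : ℕ) : ℤ) ∣ a - sigma (k - 1) n := by
  obtain ⟨g, hgmem, hgcoeff, -⟩ := exists_integral_cuspForm_congr_eisensteinG hk hk2
  -- `g = a₁(g) • f`, `a₁(g) = u ≡ D_k (mod N_k)`
  obtain ⟨u, hu, hudvd⟩ := hgcoeff 1 one_pos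
  obtain ⟨m, hm, hmdvd⟩ := hgcoeff n hn
  have hgf : g = (u : ℂ) • f := by rw [hu]; exact eq_coeff_one_smul_of_finrank_eq_one hd hf g
  -- `a_n(f)` is an algebraic integer and `u a_n(f) = m ∈ ℤ`; we show `a_n(f) ∈ ℤ` directly from `dim = 1`:
  -- `S_k(ℤ)` contains an element with `a₁ = 1` (the tree's integral basis), which must be `f`.
  haveI : FiniteDimensional ℂ (CuspForm 𝒮ℒ (k : ℤ)) := Module.finite_of_finrank_eq_succ hd
  obtain ⟨ι, _, b, hbmem, -⟩ := exists_basis_mem_levelOneIntegralCuspForms (k : ℤ)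
  have hcard : Fintype.card ι = 1 := by rw [← Module.finrank_eq_card_basis b, hd]
  obtain ⟨i⟩ : Nonempty ι := Fintype.card_pos_iff.mp (by omega)
  have hbi : b i ∈ levelOneIntegralCuspForms k := hbmem i
  have hbif : b i = (qExpansion 1 ⇑(b i)).coeff 1 • f := eq_coeff_one_smul_of_finrank_eq_one hd hf (b i)
  obtain ⟨v, hv⟩ := mem_levelOneIntegralCuspForms.mp hbi 1
  have hv0 : (v : ℂ) ≠ 0 := by
    intro h0
    rw [← hv, h0, zero_smul] at hbif
    exact b.ne_zero i hbif
  -- `f = v⁻¹ b i`, so `v a_n(f) ∈ ℤ` for all `n`; also `u a_n(f) ∈ ℤ`; and `a_n(f)` is an algebraic integer.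
  -- Simplest: `a_n(f)` is a rational algebraic integer. We use `u a_n(f) = m`, `v a_n(f) = w`, and
  -- `gcd`-free argument: `a_n(f)` is integral over `ℤ` (tree) and rational, hence an integer.
  have hint : IsIntegral ℤ ((qExpansion 1 ⇑f).coeff n) := hf.isIntegral_coeff hn
  obtain ⟨w, hw⟩ := mem_levelOneIntegralCuspForms.mp hbi n
  have hfn : (qExpansion 1 ⇑f).coeff n = (w : ℂ) / (v : ℂ) := by
    have := congrArg (fun F : CuspForm 𝒮ℒ k => (qExpansion 1 ⇑F).coeff n) hbif
    simp only [CuspForm.IsGLPos.coe_smul, ModularForm.qExpansion_smul one_pos one_mem_strictPeriods_SL, map_smul,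
      smul_eq_mul] at this
    rw [← hv, ← hw] at this
    rw [eq_div_iff hv0, mul_comm, this]
  have hrat : ((w / v : ℚ) : ℂ) = (qExpansion 1 ⇑f).coeff n := by rw [hfn]; push_cast; rfl
  have hintQ : IsIntegral ℤ ((w : ℚ) / v) := by
    have h := hint
    rw [← hrat] at h
    refine (isIntegral_algebraMap_iff (B := ℂ) (algebraMap ℚ ℂ).injective).mp ?_
    rwa [eq_ratCast]
  obtain ⟨a, ha⟩ := IsIntegrallyClosed.isIntegral_iff.mp hintQ
  rw [eq_intCast] at ha
  refine ⟨a, ?_, ?_⟩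
  · rw [← hrat, ← ha]
    push_cast
    rfl
  · -- from `g = u • f`: `m = u a`, and `u ≡ D_k`, `m ≡ D_k σ (mod N_k)`, `(D_k, N_k) = 1` ⟹ `a ≡ σ`.
    have hma : m = u * a := by
      have := hm
      rw [hgf, CuspForm.IsGLPos.coe_smul, ModularForm.qExpansion_smul one_pos one_mem_strictPeriods_SL, map_smul,
        smul_eq_mul, ← hrat, ← ha] at this
      exact_mod_cast this
    rw [sigma_one, Nat.cast_one, mul_one] at hudvd
    -- `N ∣ u a − D σ` and `N ∣ u − D` ⟹ `N ∣ D (a − σ)` ⟹ `N ∣ a − σ`.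
    have h1 : ((eisensteinNumerator k : ℕ) : ℤ) ∣ (eisensteinDenominator k : ℤ) * (a - sigma (k - 1) n) := by
      have h2 : ((eisensteinNumerator k : ℕ) : ℤ) ∣ (u - eisensteinDenominator k) * a := Dvd.dvd.mul_right hudvd a
      have h3 := Int.dvd_sub (hma ▸ hmdvd) h2
      have : u * a - (eisensteinDenominator k : ℤ) * (sigma (k - 1) n : ℕ) - (u - eisensteinDenominator k) * a =
          (eisensteinDenominator k : ℤ) * (a - sigma (k - 1) n) := by ring
      rwa [this] at h3
    exact Int.dvd_of_dvd_mul_right_of_gcd_one h1 (by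
      rw [Int.gcd_natCast_natCast]
      exact eisensteinNumerator_coprime_eisensteinDenominator k)

end CorollaryOneOne

end Literature.NumberTheory.ModularForms
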